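import Summits.CriticalPhenomena.PercolationContinuityZ3.Theorems.SahiIsingBoxTP2
import Summits.CriticalPhenomena.PercolationContinuityZ3.Theorems.SahiBoxTP2BooleanSpinsCountable

/-!
# Sahi positivity of the infinite-volume Ising states `μ⁺`, `μ⁻`, `μ^∅` given `C_n`; unconditional FKG

Support file of the Sahi cell (`prim-sahi`, typer seat, generation 13; `--supports stmt-CriticalPhenomena-4575`).
Theorems only (no definitions, no named facts, no sorries).  Built on `SahiIsingBoxTP2.lean` (the finite-volume
Ising measures and their thermodynamic limits are box-TP₂ on `{−1,+1}^V`) and on generation 12's two-valued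
theorem `msahiE_nonneg_of_isBoxTP2_spins_countable` (`SahiBoxTP2BooleanSpinsCountable.lean`).

* `msahiE_nonneg_of_isBoxTP2_spinConfig` — transport along the coordinatewise order isomorphism
  `{−1,+1} ≃ {0,1}` (`unitsIntEquivBool`, both adjoints, `IsBoxTP2.map_of_galoisConnection`): given
  `∀ d, LiebSahiContinuum d n`, every box-TP₂ probability measure on `{−1,+1}^ι` (`ι` countably infinite) has
  `E_n(f_0,…,f_{n−1}) ≥ 0` for ALL measurable nonnegative monotone `f_i` (+ `_antitone`, `_of_sahiConjecture`);
  unconditionally the FKG inequality `integral_mul_integral_le_of_isBoxTP2_spinConfig`.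
* THE ISING THEOREMS (`d ≥ 1`): `plusState_msahiE_nonneg`, `minusState_msahiE_nonneg` (`β ≥ 0`, every `h`),
  `freeState_msahiE_nonneg` (`β, h ≥ 0`) (+ `_antitone`, `_of_sahiConjecture`): **given `C_n`, the infinite-volume
  plus, minus and free Ising states on `ℤ^d` — any probability measure with their correlations — satisfy
  `E_n(f_0,…,f_{n−1}) ≥ 0` for all measurable nonnegative increasing functionals of the infinite configuration**
  (e.g. indicators of increasing tail events such as `{x ↔ ∞ through + spins}`); UNCONDITIONALLY these states are
  positively associated for all such functionals (`plusState_integral_mul_integral_le`, …) — the infinite-volume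
  FKG inequality beyond local observables; `exists_plusState_isBoxTP2` / `exists_minusState_isBoxTP2` package the
  statements with the tree's existence theorems `exists_plusMeasure_holds` / `exists_minusMeasure_holds` (a
  translation-invariant DLR measure with the `±` correlations which is box-TP₂ and, given `C_n`, Sahi-positive).

No sorries, no new axioms.
-/

noncomputable section

namespace Summit.CriticalPhenomena.PercolationContinuityZ3.Theorems.SahiBoxTP2

open MeasureTheory ProbabilityTheory Set Filter Topology Function Literature.Combinatorics.Sahi2008
open Literature.Probability.LatticeModels
open scoped ENNReal

/-! ### Sahi positivity on `{−1,+1}^ι`: transport along `{−1,+1} ≃ {0,1}` -/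

section Transport

variable {ι : Type*}

/-- `u ↦ [u = 1]` is monotone (`−1 < 1`, `false < true`). [folklore] -/
theorem unitsIntEquivBool_mono : Monotone (unitsIntEquivBool : ℤˣ → Bool) := by
  intro u v huv
  change decide (u = 1) ≤ decide (v = 1)
  rcases Int.units_eq_one_or u with rfl | rfl <;> rcases Int.units_eq_one_or v with rfl | rfl
  · exact le_rfl
  · exact absurd huv (by decide)
  · decide
  · exact le_rfl

/-- `b ↦ if b then 1 else −1` is monotone. [folklore] -/
theorem unitsIntEquivBool_symm_mono : Monotone (unitsIntEquivBool.symm : Bool → ℤˣ) := by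
  intro x y hxy
  change (if x then (1 : ℤˣ) else -1) ≤ (if y then (1 : ℤˣ) else -1)
  cases x <;> cases y
  · exact le_rfl
  · decide
  · exact absurd hxy (by decide)
  · exact le_rfl

/-- The order isomorphism `{−1,+1} ≃ {0,1}` as a Galois connection. [folklore] -/
theorem galoisConnection_unitsIntEquivBool :
    GaloisConnection (unitsIntEquivBool : ℤˣ → Bool) (unitsIntEquivBool.symm : Bool → ℤˣ) := fun u b =>
  ⟨fun hle => by simpa only [MeasurableEquiv.symm_apply_apply] using unitsIntEquivBool_symm_mono hle,
    fun hle => by simpa only [MeasurableEquiv.apply_symm_apply] using unitsIntEquivBool_mono hle⟩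

/-- The inverse order isomorphism as a Galois connection. [folklore] -/
theorem galoisConnection_unitsIntEquivBool_symm :
    GaloisConnection (unitsIntEquivBool.symm : Bool → ℤˣ) (unitsIntEquivBool : ℤˣ → Bool) := fun b u =>
  ⟨fun hle => by simpa only [MeasurableEquiv.apply_symm_apply] using unitsIntEquivBool_mono hle,
    fun hle => by simpa only [MeasurableEquiv.symm_apply_apply] using unitsIntEquivBool_symm_mono hle⟩

/-- Coordinatewise: `(σ ↦ ([σ_i = 1])_i)` evaluated. [folklore] -/
theorem piCongrRight_unitsIntEquivBool_apply (σ : ι → ℤˣ) (i : ι) :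
    (MeasurableEquiv.piCongrRight fun _ : ι => unitsIntEquivBool) σ i = unitsIntEquivBool (σ i) := rfl

/-- Coordinatewise inverse evaluated. [folklore] -/
theorem piCongrRight_unitsIntEquivBool_symm_apply (u : ι → Bool) (i : ι) :
    (MeasurableEquiv.piCongrRight fun _ : ι => unitsIntEquivBool).symm u i = unitsIntEquivBool.symm (u i) := rfl

/-- The coordinatewise map `{−1,+1}^ι → {0,1}^ι` is monotone. [folklore] -/
theorem piCongrRight_unitsIntEquivBool_mono :
    Monotone (MeasurableEquiv.piCongrRight fun _ : ι => unitsIntEquivBool) := fun _ _ h i =>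
  unitsIntEquivBool_mono (h i)

/-- Its inverse is monotone. [folklore] -/
theorem piCongrRight_unitsIntEquivBool_symm_mono :
    Monotone (MeasurableEquiv.piCongrRight fun _ : ι => unitsIntEquivBool).symm := fun _ _ h i =>
  unitsIntEquivBool_symm_mono (h i)

/-- **Box-TP₂ passes from `{−1,+1}^ι` to `{0,1}^ι`** along the coordinatewise order isomorphism (`ι` countable).
[folklore] -/
theorem IsBoxTP2.map_piCongrRight_unitsIntEquivBool [Countable ι] {μ : Measure (ι → ℤˣ)} (hμ : IsBoxTP2 μ) :
    IsBoxTP2 (μ.map (MeasurableEquiv.piCongrRight fun _ : ι => unitsIntEquivBool)) := by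
  refine hμ.map_of_galoisConnection (MeasurableEquiv.measurable _)
    (l := (MeasurableEquiv.piCongrRight fun _ : ι => unitsIntEquivBool).symm)
    (r := (MeasurableEquiv.piCongrRight fun _ : ι => unitsIntEquivBool).symm) ?_ ?_
    fun a b => measurableSet_Icc_pi_of_countable a b
  · intro u σ
    constructor
    · intro hle i
      have := galoisConnection_unitsIntEquivBool_symm (u i) (σ i)
      rw [piCongrRight_unitsIntEquivBool_apply]
      exact this.1 (by simpa only [piCongrRight_unitsIntEquivBool_symm_apply] using hle i)
    · intro hle i
      have := galoisConnection_unitsIntEquivBool_symm (u i) (σ i)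
      rw [piCongrRight_unitsIntEquivBool_symm_apply]
      exact this.2 (by simpa only [piCongrRight_unitsIntEquivBool_apply] using hle i)
  · intro σ u
    constructor
    · intro hle i
      have := galoisConnection_unitsIntEquivBool (σ i) (u i)
      rw [piCongrRight_unitsIntEquivBool_symm_apply]
      exact this.1 (by simpa only [piCongrRight_unitsIntEquivBool_apply] using hle i)
    · intro hle i
      have := galoisConnection_unitsIntEquivBool (σ i) (u i)
      rw [piCongrRight_unitsIntEquivBool_apply]
      exact this.2 (by simpa only [piCongrRight_unitsIntEquivBool_symm_apply] using hle i)

variable {n : ℕ}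

/-- **`(∀ d, LiebSahiContinuum d n)` ⟹ every box-TP₂ probability measure on `{−1,+1}^ι` (`ι` countably infinite) is
Sahi-positive of order `n`** for ALL measurable nonnegative monotone functionals (transport of the two-valued
theorem `msahiE_nonneg_of_isBoxTP2_spins_countable` along `{−1,+1} ≃o {0,1}`). [this work] -/
theorem msahiE_nonneg_of_isBoxTP2_spinConfig [Countable ι] [Infinite ι] (hL : ∀ d, LiebSahiContinuum d n)
    (μ : Measure (ι → ℤˣ)) [IsProbabilityMeasure μ] (hμ : IsBoxTP2 μ) (f : Fin n → (ι → ℤˣ) → ℝ)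
    (hfm : ∀ i, Measurable (f i)) (hf0 : ∀ i σ, 0 ≤ f i σ) (hmono : ∀ i, Monotone (f i)) :
    0 ≤ msahiE μ n f := by
  obtain ⟨D⟩ := nonempty_denumerable ι
  set S := (MeasurableEquiv.piCongrRight fun _ : ι => unitsIntEquivBool) with hSdef
  haveI : IsProbabilityMeasure (μ.map S) := Measure.isProbabilityMeasure_map S.measurable.aemeasurable
  have hmp : MeasurePreserving S μ (μ.map S) := ⟨S.measurable, rfl⟩
  have key := msahiE_nonneg_of_isBoxTP2_spins_countable (Denumerable.eqv ι) hL (μ.map S)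
    hμ.map_piCongrRight_unitsIntEquivBool (fun i => f i ∘ S.symm) (fun i => (hfm i).comp S.symm.measurable)
    (fun i u => hf0 i _) fun i u v huv => hmono i (piCongrRight_unitsIntEquivBool_symm_mono huv)
  rw [← msahiE_comp_measurePreserving hmp S.measurableEmbedding n _] at key
  have e : (fun i => (f i ∘ S.symm) ∘ S) = f := by
    funext i σ
    simp only [Function.comp_apply, MeasurableEquiv.symm_apply_apply]
  rwa [e] at key

/-- Decreasing families. [this work] -/
theorem msahiE_nonneg_of_isBoxTP2_spinConfig_antitone [Countable ι] [Infinite ι] (hL : ∀ d, LiebSahiContinuum d n)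
    (μ : Measure (ι → ℤˣ)) [IsProbabilityMeasure μ] (hμ : IsBoxTP2 μ) (f : Fin n → (ι → ℤˣ) → ℝ)
    (hfm : ∀ i, Measurable (f i)) (hf0 : ∀ i σ, 0 ≤ f i σ) (hanti : ∀ i, Antitone (f i)) :
    0 ≤ msahiE μ n f := by
  obtain ⟨D⟩ := nonempty_denumerable ι
  set S := (MeasurableEquiv.piCongrRight fun _ : ι => unitsIntEquivBool) with hSdef
  haveI : IsProbabilityMeasure (μ.map S) := Measure.isProbabilityMeasure_map S.measurable.aemeasurable
  have hmp : MeasurePreserving S μ (μ.map S) := ⟨S.measurable, rfl⟩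
  have key := msahiE_nonneg_of_isBoxTP2_spins_countable_antitone (Denumerable.eqv ι) hL (μ.map S)
    hμ.map_piCongrRight_unitsIntEquivBool (fun i => f i ∘ S.symm) (fun i => (hfm i).comp S.symm.measurable)
    (fun i u => hf0 i _) fun i u v huv => hanti i (piCongrRight_unitsIntEquivBool_symm_mono huv)
  rw [← msahiE_comp_measurePreserving hmp S.measurableEmbedding n _] at key
  have e : (fun i => (f i ∘ S.symm) ∘ S) = f := by
    funext i σ
    simp only [Function.comp_apply, MeasurableEquiv.symm_apply_apply]
  rwa [e] at key

/-- From `C_n`. [this work; cite: Sahi2008, Conj. 5 (p. 212); LiebSahi2021, Conj. 1.1] -/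
theorem msahiE_nonneg_of_isBoxTP2_spinConfig_of_sahiConjecture [Countable ι] [Infinite ι] (hC : SahiConjecture n)
    (μ : Measure (ι → ℤˣ)) [IsProbabilityMeasure μ] (hμ : IsBoxTP2 μ) (f : Fin n → (ι → ℤˣ) → ℝ)
    (hfm : ∀ i, Measurable (f i)) (hf0 : ∀ i σ, 0 ≤ f i σ) (hmono : ∀ i, Monotone (f i)) :
    0 ≤ msahiE μ n f :=
  msahiE_nonneg_of_isBoxTP2_spinConfig ((sahiConjecture_iff_forall_liebSahiContinuum n).1 hC) μ hμ f hfm hf0 hmono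

/-- **Unconditionally: the FKG inequality for box-TP₂ probability measures on `{−1,+1}^ι`** (`ι` countably infinite),
all measurable nonnegative monotone `f, g` (functionals of the whole configuration). [this work] -/
theorem integral_mul_integral_le_of_isBoxTP2_spinConfig [Countable ι] [Infinite ι] (μ : Measure (ι → ℤˣ))
    [IsProbabilityMeasure μ] (hμ : IsBoxTP2 μ) {f g : (ι → ℤˣ) → ℝ} (hfm : Measurable f) (hgm : Measurable g)
    (hf0 : ∀ σ, 0 ≤ f σ) (hg0 : ∀ σ, 0 ≤ g σ) (hf : Monotone f) (hg : Monotone g) :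
    (∫ σ, f σ ∂μ) * (∫ σ, g σ ∂μ) ≤ ∫ σ, f σ * g σ ∂μ := by
  have h := msahiE_nonneg_of_isBoxTP2_spinConfig (fun d => liebSahiContinuum_of_order_le_two d le_rfl) μ hμ
    ![f, g] (fun i => by fin_cases i <;> assumption) (fun i => by fin_cases i <;> assumption)
    (fun i => by fin_cases i <;> assumption)
  rw [msahiE_two] at h
  linarith

end Transport

/-! ### The theorems for the infinite-volume Ising states on `ℤ^d` -/

section Ising

variable {d : ℕ} [NeZero d] {β h : ℝ} {n : ℕ}

/-- `ℤ^d` is infinite for `d ≥ 1`. [folklore] -/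
theorem infinite_site_of_neZero : Infinite (Site d) := by
  haveI : Nonempty (Fin d) := ⟨0⟩
  exact Pi.infinite_of_right

/-- **THE PLUS STATE IS SAHI-POSITIVE GIVEN `C_n`.**  For `d ≥ 1`, `β ≥ 0`, any `h`: if `LiebSahiContinuum d' n`
holds for every `d'` (⟺ `SahiConjecture n`), then every probability measure on `{−1,+1}^{ℤ^d}` with the plus
correlations — the plus state `μ⁺_{β,h}` — satisfies `E_n(f_0,…,f_{n−1}) ≥ 0` for ALL measurable nonnegative
increasing functionals `f_i` of the infinite configuration. [this work] -/
theorem plusState_msahiE_nonneg (hL : ∀ d', LiebSahiContinuum d' n) (hβ : 0 ≤ β)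
    (μ : Measure (SpinConfig (Site d))) [IsProbabilityMeasure μ]
    (hμ : ∀ B : Finset (Site d), spinCorr μ B = plusCorr d β h B) (f : Fin n → SpinConfig (Site d) → ℝ)
    (hfm : ∀ i, Measurable (f i)) (hf0 : ∀ i σ, 0 ≤ f i σ) (hmono : ∀ i, Monotone (f i)) : 0 ≤ msahiE μ n f := by
  haveI : Infinite (Site d) := infinite_site_of_neZero
  exact msahiE_nonneg_of_isBoxTP2_spinConfig hL μ (isBoxTP2_of_forall_spinCorr_eq_plusCorr hβ μ hμ) f hfm hf0
    hmono

/-- The plus state, decreasing functionals. [this work] -/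
theorem plusState_msahiE_nonneg_antitone (hL : ∀ d', LiebSahiContinuum d' n) (hβ : 0 ≤ β)
    (μ : Measure (SpinConfig (Site d))) [IsProbabilityMeasure μ]
    (hμ : ∀ B : Finset (Site d), spinCorr μ B = plusCorr d β h B) (f : Fin n → SpinConfig (Site d) → ℝ)
    (hfm : ∀ i, Measurable (f i)) (hf0 : ∀ i σ, 0 ≤ f i σ) (hanti : ∀ i, Antitone (f i)) : 0 ≤ msahiE μ n f := by
  haveI : Infinite (Site d) := infinite_site_of_neZero
  exact msahiE_nonneg_of_isBoxTP2_spinConfig_antitone hL μ (isBoxTP2_of_forall_spinCorr_eq_plusCorr hβ μ hμ) f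
    hfm hf0 hanti

/-- The plus state, from `C_n`. [this work; cite: Sahi2008, Conj. 5 (p. 212); LiebSahi2021, Conj. 1.1] -/
theorem plusState_msahiE_nonneg_of_sahiConjecture (hC : SahiConjecture n) (hβ : 0 ≤ β)
    (μ : Measure (SpinConfig (Site d))) [IsProbabilityMeasure μ]
    (hμ : ∀ B : Finset (Site d), spinCorr μ B = plusCorr d β h B) (f : Fin n → SpinConfig (Site d) → ℝ)
    (hfm : ∀ i, Measurable (f i)) (hf0 : ∀ i σ, 0 ≤ f i σ) (hmono : ∀ i, Monotone (f i)) : 0 ≤ msahiE μ n f :=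
  plusState_msahiE_nonneg ((sahiConjecture_iff_forall_liebSahiContinuum n).1 hC) hβ μ hμ f hfm hf0 hmono

/-- **UNCONDITIONALLY: the plus state is positively associated for ALL measurable nonnegative increasing
functionals of the infinite configuration** (`d ≥ 1`, `β ≥ 0`, any `h`) — the infinite-volume FKG inequality
beyond local observables. [this work] -/
theorem plusState_integral_mul_integral_le (hβ : 0 ≤ β) (μ : Measure (SpinConfig (Site d)))
    [IsProbabilityMeasure μ] (hμ : ∀ B : Finset (Site d), spinCorr μ B = plusCorr d β h B)
    {f g : SpinConfig (Site d) → ℝ} (hfm : Measurable f) (hgm : Measurable g) (hf0 : ∀ σ, 0 ≤ f σ)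
    (hg0 : ∀ σ, 0 ≤ g σ) (hf : Monotone f) (hg : Monotone g) :
    (∫ σ, f σ ∂μ) * (∫ σ, g σ ∂μ) ≤ ∫ σ, f σ * g σ ∂μ := by
  haveI : Infinite (Site d) := infinite_site_of_neZero
  exact integral_mul_integral_le_of_isBoxTP2_spinConfig μ (isBoxTP2_of_forall_spinCorr_eq_plusCorr hβ μ hμ) hfm hgm
    hf0 hg0 hf hg

/-- **THE MINUS STATE IS SAHI-POSITIVE GIVEN `C_n`** (`d ≥ 1`, `β ≥ 0`, any `h`; increasing functionals).
[this work] -/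
theorem minusState_msahiE_nonneg (hL : ∀ d', LiebSahiContinuum d' n) (hβ : 0 ≤ β)
    (μ : Measure (SpinConfig (Site d))) [IsProbabilityMeasure μ]
    (hμ : ∀ B : Finset (Site d), spinCorr μ B = minusCorr d β h B) (f : Fin n → SpinConfig (Site d) → ℝ)
    (hfm : ∀ i, Measurable (f i)) (hf0 : ∀ i σ, 0 ≤ f i σ) (hmono : ∀ i, Monotone (f i)) : 0 ≤ msahiE μ n f := by
  haveI : Infinite (Site d) := infinite_site_of_neZero
  exact msahiE_nonneg_of_isBoxTP2_spinConfig hL μ (isBoxTP2_of_forall_spinCorr_eq_minusCorr hβ μ hμ) f hfm hf0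
    hmono

/-- The minus state, decreasing functionals. [this work] -/
theorem minusState_msahiE_nonneg_antitone (hL : ∀ d', LiebSahiContinuum d' n) (hβ : 0 ≤ β)
    (μ : Measure (SpinConfig (Site d))) [IsProbabilityMeasure μ]
    (hμ : ∀ B : Finset (Site d), spinCorr μ B = minusCorr d β h B) (f : Fin n → SpinConfig (Site d) → ℝ)
    (hfm : ∀ i, Measurable (f i)) (hf0 : ∀ i σ, 0 ≤ f i σ) (hanti : ∀ i, Antitone (f i)) : 0 ≤ msahiE μ n f := by
  haveI : Infinite (Site d) := infinite_site_of_neZero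
  exact msahiE_nonneg_of_isBoxTP2_spinConfig_antitone hL μ (isBoxTP2_of_forall_spinCorr_eq_minusCorr hβ μ hμ) f
    hfm hf0 hanti

/-- The minus state, from `C_n`. [this work; cite: Sahi2008, Conj. 5 (p. 212); LiebSahi2021, Conj. 1.1] -/
theorem minusState_msahiE_nonneg_of_sahiConjecture (hC : SahiConjecture n) (hβ : 0 ≤ β)
    (μ : Measure (SpinConfig (Site d))) [IsProbabilityMeasure μ]
    (hμ : ∀ B : Finset (Site d), spinCorr μ B = minusCorr d β h B) (f : Fin n → SpinConfig (Site d) → ℝ)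
    (hfm : ∀ i, Measurable (f i)) (hf0 : ∀ i σ, 0 ≤ f i σ) (hmono : ∀ i, Monotone (f i)) : 0 ≤ msahiE μ n f :=
  minusState_msahiE_nonneg ((sahiConjecture_iff_forall_liebSahiContinuum n).1 hC) hβ μ hμ f hfm hf0 hmono

/-- **UNCONDITIONALLY: the minus state is positively associated for all measurable nonnegative increasing
functionals of the infinite configuration.** [this work] -/
theorem minusState_integral_mul_integral_le (hβ : 0 ≤ β) (μ : Measure (SpinConfig (Site d)))
    [IsProbabilityMeasure μ] (hμ : ∀ B : Finset (Site d), spinCorr μ B = minusCorr d β h B)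
    {f g : SpinConfig (Site d) → ℝ} (hfm : Measurable f) (hgm : Measurable g) (hf0 : ∀ σ, 0 ≤ f σ)
    (hg0 : ∀ σ, 0 ≤ g σ) (hf : Monotone f) (hg : Monotone g) :
    (∫ σ, f σ ∂μ) * (∫ σ, g σ ∂μ) ≤ ∫ σ, f σ * g σ ∂μ := by
  haveI : Infinite (Site d) := infinite_site_of_neZero
  exact integral_mul_integral_le_of_isBoxTP2_spinConfig μ (isBoxTP2_of_forall_spinCorr_eq_minusCorr hβ μ hμ) hfm
    hgm hf0 hg0 hf hg

/-- **THE FREE STATE IS SAHI-POSITIVE GIVEN `C_n`** (`d ≥ 1`, `β ≥ 0`, `h ≥ 0`; increasing functionals).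
[this work] -/
theorem freeState_msahiE_nonneg (hL : ∀ d', LiebSahiContinuum d' n) (hβ : 0 ≤ β) (hh : 0 ≤ h)
    (μ : Measure (SpinConfig (Site d))) [IsProbabilityMeasure μ]
    (hμ : ∀ B : Finset (Site d), spinCorr μ B = freeCorr d β h B) (f : Fin n → SpinConfig (Site d) → ℝ)
    (hfm : ∀ i, Measurable (f i)) (hf0 : ∀ i σ, 0 ≤ f i σ) (hmono : ∀ i, Monotone (f i)) : 0 ≤ msahiE μ n f := by
  haveI : Infinite (Site d) := infinite_site_of_neZero
  exact msahiE_nonneg_of_isBoxTP2_spinConfig hL μ (isBoxTP2_of_forall_spinCorr_eq_freeCorr hβ hh μ hμ) f hfm hf0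
    hmono

/-- The free state, from `C_n`. [this work; cite: Sahi2008, Conj. 5 (p. 212); LiebSahi2021, Conj. 1.1] -/
theorem freeState_msahiE_nonneg_of_sahiConjecture (hC : SahiConjecture n) (hβ : 0 ≤ β) (hh : 0 ≤ h)
    (μ : Measure (SpinConfig (Site d))) [IsProbabilityMeasure μ]
    (hμ : ∀ B : Finset (Site d), spinCorr μ B = freeCorr d β h B) (f : Fin n → SpinConfig (Site d) → ℝ)
    (hfm : ∀ i, Measurable (f i)) (hf0 : ∀ i σ, 0 ≤ f i σ) (hmono : ∀ i, Monotone (f i)) : 0 ≤ msahiE μ n f :=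
  freeState_msahiE_nonneg ((sahiConjecture_iff_forall_liebSahiContinuum n).1 hC) hβ hh μ hμ f hfm hf0 hmono

/-- **UNCONDITIONALLY: the free state (`h ≥ 0`) is positively associated for all measurable nonnegative increasing
functionals of the infinite configuration.** [this work] -/
theorem freeState_integral_mul_integral_le (hβ : 0 ≤ β) (hh : 0 ≤ h) (μ : Measure (SpinConfig (Site d)))
    [IsProbabilityMeasure μ] (hμ : ∀ B : Finset (Site d), spinCorr μ B = freeCorr d β h B)
    {f g : SpinConfig (Site d) → ℝ} (hfm : Measurable f) (hgm : Measurable g) (hf0 : ∀ σ, 0 ≤ f σ)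
    (hg0 : ∀ σ, 0 ≤ g σ) (hf : Monotone f) (hg : Monotone g) :
    (∫ σ, f σ ∂μ) * (∫ σ, g σ ∂μ) ≤ ∫ σ, f σ * g σ ∂μ := by
  haveI : Infinite (Site d) := infinite_site_of_neZero
  exact integral_mul_integral_le_of_isBoxTP2_spinConfig μ (isBoxTP2_of_forall_spinCorr_eq_freeCorr hβ hh μ hμ)
    hfm hgm hf0 hg0 hf hg

/-- **Packaged with the existence theorem: the plus state `μ⁺_{β,h}` as a box-TP₂ DLR measure.**  For `d ≥ 1`,
`β ≥ 0` and every `h` there is a probability measure on `{−1,+1}^{ℤ^d}` which is a Gibbs measure for the Ising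
specification, translation invariant, has the plus correlations, is box-TP₂, and — given `C_n` — is Sahi-positive
of order `n` for all measurable nonnegative increasing functionals. [this work] -/
theorem exists_plusState_isBoxTP2 (hβ : 0 ≤ β) (h : ℝ) :
    ∃ μ ∈ isingGibbsMeasures d β h, IsProbabilityMeasure μ ∧ IsTranslationInvariantMeasure μ ∧
      (∀ B : Finset (Site d), spinCorr μ B = plusCorr d β h B) ∧ IsBoxTP2 μ ∧
      ∀ n : ℕ, (∀ d', LiebSahiContinuum d' n) → ∀ f : Fin n → SpinConfig (Site d) → ℝ,
        (∀ i, Measurable (f i)) → (∀ i σ, 0 ≤ f i σ) → (∀ i, Monotone (f i)) → 0 ≤ msahiE μ n f := by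
  obtain ⟨μ, hμG, hμT, hμc⟩ := exists_plusMeasure_holds (d := d) (β := β) (h := h) hβ
  have hG : IsGibbsMeasure (isingSpecification (zdGraph d) β h) μ := hμG
  haveI := hG.isProbabilityMeasure
  exact ⟨μ, hμG, inferInstance, hμT, hμc, isBoxTP2_of_forall_spinCorr_eq_plusCorr hβ μ hμc,
    fun n hL f hfm hf0 hmono => plusState_msahiE_nonneg hL hβ μ hμc f hfm hf0 hmono⟩

/-- **The minus state `μ⁻_{β,h}` as a box-TP₂ DLR measure**, Sahi-positive of order `n` given `C_n`. [this work] -/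
theorem exists_minusState_isBoxTP2 (hβ : 0 ≤ β) (h : ℝ) :
    ∃ μ ∈ isingGibbsMeasures d β h, IsProbabilityMeasure μ ∧ IsTranslationInvariantMeasure μ ∧
      (∀ B : Finset (Site d), spinCorr μ B = minusCorr d β h B) ∧ IsBoxTP2 μ ∧
      ∀ n : ℕ, (∀ d', LiebSahiContinuum d' n) → ∀ f : Fin n → SpinConfig (Site d) → ℝ,
        (∀ i, Measurable (f i)) → (∀ i σ, 0 ≤ f i σ) → (∀ i, Monotone (f i)) → 0 ≤ msahiE μ n f := by
  obtain ⟨μ, hμG, hμT, hμc⟩ := exists_minusMeasure_holds (d := d) (β := β) (h := h) hβ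
  have hG : IsGibbsMeasure (isingSpecification (zdGraph d) β h) μ := hμG
  haveI := hG.isProbabilityMeasure
  exact ⟨μ, hμG, inferInstance, hμT, hμc, isBoxTP2_of_forall_spinCorr_eq_minusCorr hβ μ hμc,
    fun n hL f hfm hf0 hmono => minusState_msahiE_nonneg hL hβ μ hμc f hfm hf0 hmono⟩

end Ising

end Summit.CriticalPhenomena.PercolationContinuityZ3.Theorems.SahiBoxTP2
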